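import Summits.NavierStokesRegularity.TurbBounds.LadderTail
import HarnessLib

/-!
# Tail lemma, generic truncation `(N, P)` — the `ℓ²` split inequality of rbsdp SPEC 3.5–3.7 on coefficient sequences
(cell `pub-turb` / `turb-bounds`; v2 groundwork for the tail lemmas of rows with `P > 0` (P2-R3: `(N,P) = (12,5), (16,5)`; P2-R4;
every RB row). The `(4, 0)` instance is `TailSeqP2R0.seq_split`.)

HONEST FRAMING: rigorous bounds for the stated PDE and boundary conditions; no claim about physical turbulence beyond the bound.
PURE SEQUENCE ALGEBRA. Truncation sizes `LW = N+P+3` (coefficients `c` of `V''`), `LT = N+P+2` (`d` of `Θ'`); tracked ladders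
`a_n, n ≤ N+P+1` (`V'`), `b_n, n ≤ N+P` (`V`), `e_n, n ≤ N+P` (`Θ`). The coupling enters as an exact tracked part `X` (any real;
for the polynomial level it is `Σ_p ĝ_p Σ_{(n,m)∈S} b_n e_m Λ(n,m,p)`) plus a remainder `Rc2` bounded à la SPEC 3.6 by
`T(ε‖w̃₀‖² + ε⁻¹‖θ̃₀‖²)` with `‖w̃₀‖² = Σ_{N<n≤N+P} w b² + (tail of b from N+P+1)` etc. (hypothesis `hR`). `seq_split_gen` bounds the
Parseval form below by the tracked finite part minus the Young/tail corrections plus the two slack terms with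
`λ_T = lam (N+P) = 4/((2LT-1)(2LT+3))`, `λ_W = lam (N+P) · lam (N+P+1)` (SPEC 3.6 `μ_W λ(LW-1,LW)`).
-/

set_option linter.style.longLine false

namespace Summit.NavierStokesRegularity.TurbBounds.TailSeqGen

open Finset Summit.NavierStokesRegularity.TurbBounds.LadderTail

/-- **Generic `(N, P)` split inequality** (rbsdp SPEC 3.5–3.7 on coefficient sequences). -/
theorem seq_split_gen (N P L : ℕ) {c a b d e : ℕ → ℝ} (hA : IsLadder c a) (hB : IsLadder a b) (hE : IsLadder d e)
    {s u v ε T X Rc2 : ℝ} (hs : 1 ≤ s) (hv : 0 ≤ v) (hε : 0 < ε) (hT : 0 ≤ T)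
    (hR : |Rc2| ≤ T * (ε * (∑ k ∈ range P, w (N + 1 + k) * b (N + 1 + k) ^ 2 + ∑ k ∈ range (L + 2), w (N + P + 1 + k) * b (N + P + 1 + k) ^ 2)
            + ε⁻¹ * (∑ k ∈ range P, w (N + 1 + k) * e (N + 1 + k) ^ 2 + ∑ k ∈ range (L + 2), w (N + P + 1 + k) * e (N + P + 1 + k) ^ 2))) :
    ((s - 1) * (16 * u * ∑ n ∈ range (N + P + 3), w n * c n ^ 2 + 8 * ∑ n ∈ range (N + P + 2), w n * a n ^ 2
          + v * ∑ n ∈ range (N + P + 1), w n * b n ^ 2)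
      + s * (4 * ∑ n ∈ range (N + P + 2), w n * d n ^ 2 + v * ∑ n ∈ range (N + P + 1), w n * e n ^ 2)
      + 2 * X
      - T * ε * (∑ k ∈ range P, w (N + 1 + k) * b (N + 1 + k) ^ 2 + phi (N + P) * a (N + P) ^ 2 + phi (N + P + 1) * a (N + P + 1) ^ 2
          + lam (N + P) * (phi (N + P + 1) * c (N + P + 1) ^ 2 + phi (N + P + 2) * c (N + P + 2) ^ 2))
      - T / ε * (∑ k ∈ range P, w (N + 1 + k) * e (N + 1 + k) ^ 2 + phi (N + P) * d (N + P) ^ 2 + phi (N + P + 1) * d (N + P + 1) ^ 2))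
    + (16 * u * (s - 1) - T * ε * (lam (N + P) * lam (N + P + 1))) * ∑ k ∈ range (L + 2), w (N + P + 3 + k) * c (N + P + 3 + k) ^ 2
    + (4 * s - T * lam (N + P) / ε) * ∑ k ∈ range (L + 2), w (N + P + 2 + k) * d (N + P + 2 + k) ^ 2
    ≤ (s - 1) * (16 * u * (∑ n ∈ range (N + P + 3), w n * c n ^ 2 + ∑ k ∈ range (L + 2), w (N + P + 3 + k) * c (N + P + 3 + k) ^ 2)
            + 8 * (∑ n ∈ range (N + P + 2), w n * a n ^ 2 + ∑ k ∈ range (L + 2), w (N + P + 2 + k) * a (N + P + 2 + k) ^ 2)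
            + v * (∑ n ∈ range (N + P + 1), w n * b n ^ 2 + ∑ k ∈ range (L + 2), w (N + P + 1 + k) * b (N + P + 1 + k) ^ 2))
      + s * (4 * (∑ n ∈ range (N + P + 2), w n * d n ^ 2 + ∑ k ∈ range (L + 2), w (N + P + 2 + k) * d (N + P + 2 + k) ^ 2)
            + v * (∑ n ∈ range (N + P + 1), w n * e n ^ 2 + ∑ k ∈ range (L + 2), w (N + P + 1 + k) * e (N + P + 1 + k) ^ 2))
      + 2 * X + Rc2 := by
  -- names for the tails
  set Rc := ∑ k ∈ range (L + 2), w (N + P + 3 + k) * c (N + P + 3 + k) ^ 2 with hRc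
  set Ra := ∑ k ∈ range (L + 2), w (N + P + 2 + k) * a (N + P + 2 + k) ^ 2 with hRa
  set Rb := ∑ k ∈ range (L + 2), w (N + P + 1 + k) * b (N + P + 1 + k) ^ 2 with hRb
  set Rd := ∑ k ∈ range (L + 2), w (N + P + 2 + k) * d (N + P + 2 + k) ^ 2 with hRd
  set Re := ∑ k ∈ range (L + 2), w (N + P + 1 + k) * e (N + P + 1 + k) ^ 2 with hRe
  set GW := ∑ k ∈ range P, w (N + 1 + k) * b (N + 1 + k) ^ 2 with hGW
  set GT := ∑ k ∈ range P, w (N + 1 + k) * e (N + 1 + k) ^ 2 with hGT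
  have hs1 : 0 ≤ s - 1 := by linarith
  have hs0 : 0 ≤ s := by linarith
  have hnn : ∀ (f : ℕ → ℝ) (j M : ℕ), 0 ≤ ∑ k ∈ range M, w (j + k) * f (j + k) ^ 2 := fun f j M =>
    sum_nonneg fun k _ => mul_nonneg (w_pos _).le (sq_nonneg _)
  have hRa0 : 0 ≤ Ra := hnn a _ _
  have hRb0 : 0 ≤ Rb := hnn b _ _
  have hRc0 : 0 ≤ Rc := hnn c _ _
  have hRd0 : 0 ≤ Rd := hnn d _ _
  have hRe0 : 0 ≤ Re := hnn e _ _
  have hGW0 : 0 ≤ GW := hnn b _ _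
  have hGT0 : 0 ≤ GT := hnn e _ _
  -- (ii) coupling remainder ≥ -T(ε(GW+Rb) + (GT+Re)/ε)
  have hcoup : -(T * ε * (GW + Rb)) - T / ε * (GT + Re) ≤ Rc2 := by
    have h := neg_abs_le Rc2
    have e1 : T * (ε * (GW + Rb) + ε⁻¹ * (GT + Re)) = T * ε * (GW + Rb) + T / ε * (GT + Re) := by ring
    rw [e1] at hR
    linarith
  -- (iii) the three ladder tail bounds
  have e1 : ∀ k, N + P + 1 + 1 + k = N + P + 2 + k := fun k => by omega
  have e2 : ∀ k, N + P + 1 + 2 + k = N + P + 3 + k := fun k => by omega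
  have hT1 : Re ≤ phi (N + P) * d (N + P) ^ 2 + phi (N + P + 1) * d (N + P + 1) ^ 2 + lam (N + P) * Rd := tail_bound hE (N + P) L
  have hT2 : Rb ≤ phi (N + P) * a (N + P) ^ 2 + phi (N + P + 1) * a (N + P + 1) ^ 2 + lam (N + P) * Ra := tail_bound hB (N + P) L
  have hT3 : Ra ≤ phi (N + P + 1) * c (N + P + 1) ^ 2 + phi (N + P + 2) * c (N + P + 2) ^ 2 + lam (N + P + 1) * Rc := by
    have h := tail_bound hA (N + P + 1) L
    simp only [e1, e2] at h
    exact h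
  -- (iv) scale
  have hTε : 0 ≤ T * ε := mul_nonneg hT hε.le
  have hTε' : 0 ≤ T / ε := div_nonneg hT hε.le
  have hl : 0 ≤ lam (N + P) := (lam_pos _).le
  have hW : T * ε * Rb ≤ T * ε * (phi (N + P) * a (N + P) ^ 2 + phi (N + P + 1) * a (N + P + 1) ^ 2
      + lam (N + P) * (phi (N + P + 1) * c (N + P + 1) ^ 2 + phi (N + P + 2) * c (N + P + 2) ^ 2 + lam (N + P + 1) * Rc)) := by
    refine mul_le_mul_of_nonneg_left (hT2.trans ?_) hTε
    have := mul_le_mul_of_nonneg_left hT3 hl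
    linarith
  have hΘ : T / ε * Re ≤ T / ε * (phi (N + P) * d (N + P) ^ 2 + phi (N + P + 1) * d (N + P + 1) ^ 2 + lam (N + P) * Rd) :=
    mul_le_mul_of_nonneg_left hT1 hTε'
  -- (i) dropped nonnegative terms
  have hdrop1 : 0 ≤ (s - 1) * (8 * Ra) := mul_nonneg hs1 (by positivity)
  have hdrop2 : 0 ≤ (s - 1) * (v * Rb) := mul_nonneg hs1 (mul_nonneg hv hRb0)
  have hdrop3 : 0 ≤ s * (v * Re) := mul_nonneg hs0 (mul_nonneg hv hRe0)
  have e5 : (4 * s - T * lam (N + P) / ε) * Rd = 4 * s * Rd - T / ε * (lam (N + P) * Rd) := by ring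
  have e6 : T * ε * (GW + Rb) = T * ε * GW + T * ε * Rb := by ring
  have e7 : T / ε * (GT + Re) = T / ε * GT + T / ε * Re := by ring
  rw [e5]
  rw [e6, e7] at hcoup
  linarith [hcoup, hW, hΘ, hdrop1, hdrop2, hdrop3]

end Summit.NavierStokesRegularity.TurbBounds.TailSeqGen
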